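import Mathlib
import Literature.Computability.AlgebraicComplexity.NewtonPolygonTau

/-!
# Crux `WordPerSuperPoly` (stmt-ValiantsHypothesis-6626), line `Sketch`, stub S2: the card's safe
# form `NewtonWordTauSlow` implies the absolute subexponential form

The idea card's "safe" transferred crux bounds the Newton vertices of the `(0,2)` entry of a sparse
bivariate word of length `L ≥ 2` by `2^{2^{K √(log L)}}`.  Completing the square
(`K' u ≤ δ u² + K'²/(4δ)` with `u = √(log L)`) gives `2^{K √(log L)} ≤ C_δ · L^δ`, whence the bound
is `≤ 2^{C_δ L^δ} ≤ A_ε · 2^{L^ε}` for every `ε > 0` (`δ = ε/2`, `A_ε` absorbing small `L`; words of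
length `≤ 1` have at most one vertex).  So `NewtonWordTauSlow` implies the absolute subexponential
form, which implies the registered stub S2 (`cancellationSubexp_of_absolute`, sibling file
`…CancellationForms`).

Helper file (`--supports stmt-ValiantsHypothesis-6626`) of the line lead.
-/

noncomputable section

-- `Summit.ValiantsHypothesis.ValiantsHypothesis.…` is the tree's mandated single-conjunct layout.
set_option linter.dupNamespace false

namespace Summit.ValiantsHypothesis.ValiantsHypothesis.Theorems.ElementaryWordLengthWordPerSuperPoly

open MvPolynomial Literature.Computability.AlgebraicComplexity

/-- `sparseMat⟦w⟧` (local notation, not a definition): the matrix of a sparse bivariate word. -/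
local notation3 (prettyPrint := false) "sparseMat⟦" w "⟧" =>
  List.prod (List.map (fun l : Fin 3 × Fin 3 × ℂ × (ℕ × ℕ) =>
    Matrix.transvection l.1 l.2.1
      (MvPolynomial.C l.2.2.1 * (MvPolynomial.X 0 ^ l.2.2.2.1 * MvPolynomial.X 1 ^ l.2.2.2.2) :
        MvPolynomial (Fin 2) ℂ)) w)

namespace CancellationFormsSlow

/-- The Newton vertex count is at most the number of monomials. [folklore] -/
theorem newtonVertexCount_le_card (f : MvPolynomial (Fin 2) ℂ) :
    newtonVertexCount f ≤ f.support.card := by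
  classical
  calc newtonVertexCount f
      ≤ ((fun e : Fin 2 →₀ ℕ => fun i : Fin 2 => ((e i : ℕ) : ℝ)) ''
          (f.support : Set (Fin 2 →₀ ℕ))).ncard :=
        Set.ncard_le_ncard extremePoints_convexHull_subset ((f.support.finite_toSet).image _)
    _ ≤ (f.support : Set (Fin 2 →₀ ℕ)).ncard := Set.ncard_image_le f.support.finite_toSet
    _ = f.support.card := Set.ncard_coe_finset _

/-- Words of length `≤ 1` have at most one Newton vertex in their `(0,2)` entry (the entry is `0`
or a single term). [folklore] -/
theorem newtonVertexCount_le_one_of_length_le_one (w : List (Fin 3 × Fin 3 × ℂ × (ℕ × ℕ)))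
    (hw : w.length ≤ 1) : newtonVertexCount (sparseMat⟦w⟧ 0 2) ≤ 1 := by
  classical
  refine (newtonVertexCount_le_card _).trans ?_
  match w, hw with
  | [], _ => simp
  | [l], _ =>
    simp only [List.map_cons, List.map_nil, List.prod_cons, List.prod_nil, mul_one]
    rw [Matrix.transvection, Matrix.add_apply, Matrix.one_apply_ne (by decide), zero_add,
      X_pow_eq_monomial, X_pow_eq_monomial, monomial_mul, C_mul_monomial, Matrix.single_apply]
    split_ifs
    · exact (Finset.card_le_card support_monomial_subset).trans (Finset.card_singleton _).le
    · simp

/-- Completing the square: `2^{K u} ≤ exp (K'²/(4δ)) · exp (δ u²)` with `K' = K log 2`, for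
`δ > 0`. [folklore] -/
theorem two_rpow_mul_le (K u : ℝ) {δ : ℝ} (hδ : 0 < δ) :
    (2 : ℝ) ^ (K * u) ≤ Real.exp ((K * Real.log 2) ^ 2 / (4 * δ)) * Real.exp (δ * u ^ 2) := by
  rw [Real.rpow_def_of_pos (by norm_num : (0 : ℝ) < 2), ← Real.exp_add]
  apply Real.exp_le_exp.2
  have h : 0 ≤ δ * (u - K * Real.log 2 / (2 * δ)) ^ 2 := by positivity
  have h' : δ * (u - K * Real.log 2 / (2 * δ)) ^ 2 =
      δ * u ^ 2 - K * Real.log 2 * u + (K * Real.log 2) ^ 2 / (4 * δ) := by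
    field_simp
    ring
  nlinarith [h, h']

end CancellationFormsSlow

open CancellationFormsSlow in
/-- **The card's safe form `NewtonWordTauSlow` implies the absolute subexponential form** (and
hence, by `cancellationSubexp_of_absolute`, the registered stub S2). [folklore] -/
theorem absolute_of_slow :
    (∃ K : ℝ, ∀ w : List (Fin 3 × Fin 3 × ℂ × (ℕ × ℕ)), (∀ l ∈ w, l.1 ≠ l.2.1) →
      2 ≤ w.length →
      (newtonVertexCount ((w.map
          (fun l : Fin 3 × Fin 3 × ℂ × (ℕ × ℕ) => Matrix.transvection l.1 l.2.1
            (MvPolynomial.C l.2.2.1 * (MvPolynomial.X 0 ^ l.2.2.2.1 * MvPolynomial.X 1 ^ l.2.2.2.2) :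
              MvPolynomial (Fin 2) ℂ))).prod 0 2) : ℝ) ≤
        (2 : ℝ) ^ ((2 : ℝ) ^ (K * Real.sqrt (Real.log (w.length : ℝ))))) →
    ∀ ε : ℝ, 0 < ε → ∃ A : ℝ, ∀ w : List (Fin 3 × Fin 3 × ℂ × (ℕ × ℕ)), (∀ l ∈ w, l.1 ≠ l.2.1) →
      (newtonVertexCount ((w.map
          (fun l : Fin 3 × Fin 3 × ℂ × (ℕ × ℕ) => Matrix.transvection l.1 l.2.1
            (MvPolynomial.C l.2.2.1 * (MvPolynomial.X 0 ^ l.2.2.2.1 * MvPolynomial.X 1 ^ l.2.2.2.2) :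
              MvPolynomial (Fin 2) ℂ))).prod 0 2) : ℝ) ≤ A * (2 : ℝ) ^ ((w.length : ℝ) ^ ε) := by
  rintro ⟨K, hK⟩ ε hε
  set δ : ℝ := ε / 2 with hδ_def
  have hδ : 0 < δ := by positivity
  set C : ℝ := Real.exp ((K * Real.log 2) ^ 2 / (4 * δ)) with hC_def
  have hCpos : 0 < C := Real.exp_pos _
  -- threshold beyond which `C L^δ ≤ L^ε`: `L^δ ≥ C`, i.e. `L ≥ C^{1/δ}`
  set L₀ : ℕ := ⌈C ^ (1 / δ)⌉₊ with hL₀_def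
  -- the constant absorbs all `L < L₀` (there `C L^δ ≤ C L₀^δ`)
  refine ⟨(2 : ℝ) ^ (C * (L₀ : ℝ) ^ δ) + 1, fun w hw => ?_⟩
  set L : ℕ := w.length with hL_def
  have hbig : (0 : ℝ) < (2 : ℝ) ^ (C * (L₀ : ℝ) ^ δ) := Real.rpow_pos_of_pos (by norm_num) _
  have hpowε : (1 : ℝ) ≤ (2 : ℝ) ^ ((L : ℝ) ^ ε) :=
    Real.one_le_rpow (by norm_num) (Real.rpow_nonneg (Nat.cast_nonneg L) ε)
  rcases lt_or_ge L 2 with hL2 | hL2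
  · -- short words: at most one vertex
    have h1 : (newtonVertexCount (sparseMat⟦w⟧ 0 2) : ℝ) ≤ 1 := by
      exact_mod_cast newtonVertexCount_le_one_of_length_le_one w (by omega)
    calc (newtonVertexCount (sparseMat⟦w⟧ 0 2) : ℝ) ≤ 1 := h1
      _ ≤ ((2 : ℝ) ^ (C * (L₀ : ℝ) ^ δ) + 1) * 1 := by linarith
      _ ≤ ((2 : ℝ) ^ (C * (L₀ : ℝ) ^ δ) + 1) * (2 : ℝ) ^ ((L : ℝ) ^ ε) :=
          mul_le_mul_of_nonneg_left hpowε (by linarith)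
  · -- long words: the slow bound, then complete the square
    have hLpos : (0 : ℝ) < L := by exact_mod_cast (show 0 < L by omega)
    have hL1 : (1 : ℝ) ≤ L := by exact_mod_cast (show 1 ≤ L by omega)
    have hlog0 : 0 ≤ Real.log (L : ℝ) := Real.log_nonneg hL1
    have h0 := hK w hw hL2
    -- `2^{K √log L} ≤ C · exp (δ log L) = C · L^δ`
    have h1 : (2 : ℝ) ^ (K * Real.sqrt (Real.log (L : ℝ))) ≤ C * (L : ℝ) ^ δ := by
      have := two_rpow_mul_le K (Real.sqrt (Real.log (L : ℝ))) hδ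
      rw [Real.sq_sqrt hlog0] at this
      rwa [Real.rpow_def_of_pos hLpos, mul_comm (Real.log (L : ℝ))]
    have h2 : (newtonVertexCount (sparseMat⟦w⟧ 0 2) : ℝ) ≤ (2 : ℝ) ^ (C * (L : ℝ) ^ δ) :=
      h0.trans (Real.rpow_le_rpow_of_exponent_le (by norm_num) h1)
    rcases lt_or_ge L L₀ with hLL₀ | hLL₀
    · -- below the threshold: absorbed by the constant
      have h3 : C * (L : ℝ) ^ δ ≤ C * (L₀ : ℝ) ^ δ := by
        apply mul_le_mul_of_nonneg_left _ hCpos.le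
        exact Real.rpow_le_rpow (Nat.cast_nonneg L) (by exact_mod_cast hLL₀.le) hδ.le
      calc (newtonVertexCount (sparseMat⟦w⟧ 0 2) : ℝ) ≤ (2 : ℝ) ^ (C * (L : ℝ) ^ δ) := h2
        _ ≤ (2 : ℝ) ^ (C * (L₀ : ℝ) ^ δ) := Real.rpow_le_rpow_of_exponent_le (by norm_num) h3
        _ ≤ ((2 : ℝ) ^ (C * (L₀ : ℝ) ^ δ) + 1) * 1 := by linarith
        _ ≤ ((2 : ℝ) ^ (C * (L₀ : ℝ) ^ δ) + 1) * (2 : ℝ) ^ ((L : ℝ) ^ ε) :=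
            mul_le_mul_of_nonneg_left hpowε (by linarith)
    · -- above the threshold: `C ≤ L^δ`, so `C L^δ ≤ L^{2δ} = L^ε`
      have hCL : C ≤ (L : ℝ) ^ δ := by
        have h4 : C ^ (1 / δ) ≤ (L : ℝ) := le_trans (Nat.le_ceil _) (by exact_mod_cast hLL₀)
        have h5 : (C ^ (1 / δ)) ^ δ ≤ (L : ℝ) ^ δ :=
          Real.rpow_le_rpow (Real.rpow_nonneg hCpos.le _) h4 hδ.le
        rwa [← Real.rpow_mul hCpos.le, one_div_mul_cancel hδ.ne', Real.rpow_one] at h5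
      have h6 : C * (L : ℝ) ^ δ ≤ (L : ℝ) ^ ε := by
        calc C * (L : ℝ) ^ δ ≤ (L : ℝ) ^ δ * (L : ℝ) ^ δ :=
              mul_le_mul_of_nonneg_right hCL (Real.rpow_nonneg (Nat.cast_nonneg L) δ)
          _ = (L : ℝ) ^ ε := by rw [← Real.rpow_add hLpos, hδ_def]; ring_nf
      calc (newtonVertexCount (sparseMat⟦w⟧ 0 2) : ℝ) ≤ (2 : ℝ) ^ (C * (L : ℝ) ^ δ) := h2
        _ ≤ (2 : ℝ) ^ ((L : ℝ) ^ ε) := Real.rpow_le_rpow_of_exponent_le (by norm_num) h6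
        _ = 1 * (2 : ℝ) ^ ((L : ℝ) ^ ε) := (one_mul _).symm
        _ ≤ ((2 : ℝ) ^ (C * (L₀ : ℝ) ^ δ) + 1) * (2 : ℝ) ^ ((L : ℝ) ^ ε) :=
            mul_le_mul_of_nonneg_right (by linarith) (by positivity)

end Summit.ValiantsHypothesis.ValiantsHypothesis.Theorems.ElementaryWordLengthWordPerSuperPoly
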